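import Summits.KontsevichZagierPeriods.KontsevichZagierPeriods.Theorems.TerasomaMultiplicationGammaHodgeSectorStubProducts
import Summits.KontsevichZagierPeriods.KontsevichZagierPeriods.Theorems.GammaHodgeSector.Negative.Canonical
import Summits.KontsevichZagierPeriods.KontsevichZagierPeriods.Theorems.TerasomaMultiplicationGammaHodgeSectorMultiplicationPair
import Summits.KontsevichZagierPeriods.KontsevichZagierPeriods.Theses.MotivatedMoves
import Summits.KontsevichZagierPeriods.KontsevichZagierPeriods.Theses.SelbergAMGM

/-!
# `GammaHodgeSector` (stmt-KontsevichZagierPeriods-3742) CONTAINS the multiplication family: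
# `MultiplicationAccessible` (stmt-KontsevichZagierPeriods-12305) is a necessary input of the line

Crux `Summit.KontsevichZagierPeriods.KontsevichZagierPeriods.Theses.TerasomaMultiplication.GammaHodgeSector`
(Deligne / Koblitz–Ogus Hodge-type Beta identities inside the Kontsevich–Zagier rules; shared
verbatim with route MotivatedMoves). The registered skeleton of the line `koblitz-ogus-halving`
closes the crux from `MultiplicationAccessible` (stmt-12305, the pure-Beta Gauss multiplication
family as box ∼ simplex equivalences) and `PositiveCancellation` (stmt-5621). This file proves that
the first input is NECESSARY, i.e. that the Γ-Hodge sector contains the multiplication family: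

* (file `…MultiplicationPair.lean`) `hodgeCondition_mult` — the multiplication pair
  `(x, y) = ((i+1)/n, s)_{i<m}` versus `(x', y') = (s, (j+1)s)_{j<m}` (`n = m + 1`) passes the
  crux's Hodge test with `k = 0` (re-indexing by the unit `u` of `ℤ/n` and Hermite's identity for
  fractional parts, `sum_fract_div_add`);
* (file `…MultiplicationPair.lean`) `prod_beta_mult` — its Deligne identity `∏ B((i+1)/n, s) = n^{ns−1} ∏ B(s, (j+1)s)` is Gauss's
  multiplication formula in Beta form (from the tree's `GaussMultiplication.real_formula`);
* `multiplicationAccessible_of_gammaHodgeSector_of_lt_den` — **`GammaHodgeSector` implies the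
  instance `(m, s)` of `MultiplicationAccessible` whenever `m < den s`** (then all exponents are
  non-integers, as the crux demands): the crux in canonical form
  (`gammaHodgeSector_iff_canonical`) gives `cubeRep x y ∼ [pt, κ] × cubeRep x' y'`, and the simplex
  side is the tree's proved chain `[S_m, …] ∼ κ · D_m(s; s) ∼ κ · Π β(s, (j+1)s)`
  (`KZ.bigSimplex_toFormalPeriod`); in particular for every `s = p/q` in lowest terms the crux
  yields the multiplication formulas of all orders `n ≤ q`;
* `multiplicationAccessible_of_selbergGammaSector` — route SelbergAMGM's Γ-sector `GammaSector`
  (stmt-5620, no Hodge test, no integrality guard) implies `MultiplicationAccessible` outright.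

So, for the planners: `12305 ∧ 5621 ⟹ 3742` (TorsionKilling) and `3742 ⟹ 12305` off the locus
`den s ≤ m` (here), `5620 ⟹ 3742 ∧ 12305` (SelbergSector + here). On the excluded locus some
simplex-side exponent `(j+1)s` is an integer and the pair is not admissible for the crux as
stated (the crux requires `Int.fract ≠ 0` of every exponent); those instances are NOT claimed here.

No new definitions; no named facts. References: Deligne, LNM 900 §7 (Thm 7.18, Koblitz–Ogus
appendix); Andrews–Askey–Roy 1999, Thm 1.5.2 / 1.8.1; Kontsevich–Zagier 2001 §1.2.
-/

noncomputable section

open MeasureTheory Set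
open scoped BigOperators

namespace Summit.KontsevichZagierPeriods.GammaHodgeSectorKO

open Literature.NumberTheory.Transcendental
open Literature.NumberTheory.Transcendental.KZ
open Summit.KontsevichZagierPeriods.GammaHodgeSectorNegative (Admissible HodgeCondition IsCubeBetaRep
  IsBallCubeRep DeligneIdentity cubeRep ballCubeRep isBallCubeRep_ballCubeRep
  equivalent_cubeRep_of_isCubeBetaRep value_of_isCubeBetaRep gammaHodgeSector_iff_canonical)
open Summit.KontsevichZagierPeriods.KontsevichZagierPeriods.Theses.TerasomaMultiplication
  (GammaHodgeSector MultiplicationAccessible)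
open Summit.KontsevichZagierPeriods.KontsevichZagierPeriods.Theses.SelbergAMGM (GammaSector)

/-! ## §3 The crux contains the multiplication family -/

/-- The box side of the instance `(m, s)` of `MultiplicationAccessible` is pinned as the crux's cube
representation of the data `((i+1)/(m+1), s)_{i<m}`. [folklore] -/
theorem isCubeBetaRep_multBox (m : ℕ) (s : ℚ) (r : IntegralRep m)
    (hrd : r.domain = {x | ∀ i, x i ∈ Set.Ioo (0:ℝ) 1})
    (hri : Set.EqOn r.integrand (fun x => ∏ i : Fin m,
      (x i) ^ ((((i:ℕ):ℝ) + 1) / ((m:ℝ) + 1) - 1) * (1 - x i) ^ ((s:ℝ) - 1)) r.domain) :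
    IsCubeBetaRep (fun i : Fin m => (((i : ℕ) : ℚ) + 1) / ((m : ℚ) + 1)) (fun _ => s) r := by
  refine ⟨hrd, fun t ht => ?_⟩
  rw [hri ht]
  refine Finset.prod_congr rfl fun i _ => ?_
  push_cast
  ring_nf

/-- **The Γ-Hodge sector contains the multiplication family off the integral locus**:
`GammaHodgeSector →` the instance `(m, s)` of `MultiplicationAccessible` for `1 ≤ m < den s`
(so that no exponent `(j+1)s`, `j < m`, nor `s`, is an integer). The pair
`((i+1)/n, s)_{i<m} | (s, (j+1)s)_{j<m}`, `k = 0`, `c = κ = n^{ns−1}` is admissible, of Hodge type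
(`hodgeCondition_mult`) and satisfies the Deligne identity (`prod_beta_mult`), so the crux gives
`cubeRep x y ∼ [pt, κ] × cubeRep x' y'`; the box side is `cubeRep x y` up to congruence and the
simplex side has the same class `κ · Π_j β(s, (j+1)s)` by the tree's scaling + Dirichlet peeling
chain. [cite: Deligne1982HodgeCycles, Thm. 7.18] -/
theorem multiplicationAccessible_of_gammaHodgeSector_of_lt_den (h : GammaHodgeSector)
    (m : ℕ) (s : ℚ) (hm : 1 ≤ m) (hs : 0 < s) (hden : m < s.den)
    (r r' : IntegralRep m) (hrd : r.domain = {x | ∀ i, x i ∈ Set.Ioo (0:ℝ) 1})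
    (hri : Set.EqOn r.integrand (fun x => ∏ i : Fin m,
      (x i) ^ ((((i:ℕ):ℝ) + 1) / ((m:ℝ) + 1) - 1) * (1 - x i) ^ ((s:ℝ) - 1)) r.domain)
    (hr'd : r'.domain = {x | (∀ i, 0 < x i) ∧ ∑ i, x i < (m:ℝ) + 1})
    (hr'i : Set.EqOn r'.integrand
      (fun x => ((∏ i, x i) * ((m:ℝ) + 1 - ∑ i, x i)) ^ ((s:ℝ) - 1)) r'.domain) :
    Equivalent r r' := by
  classical
  -- the data of the pair
  set x : Fin m → ℚ := fun i => (((i : ℕ) : ℚ) + 1) / ((m : ℚ) + 1) with hxdef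
  set y : Fin m → ℚ := fun _ => s with hydef
  set y' : Fin m → ℚ := fun j => (((j : ℕ) : ℚ) + 1) * s with hy'def
  have hsZ : Int.fract s ≠ 0 := by
    simpa using fract_natCast_mul_ne_zero (s := s) (k := 1) one_pos (by omega)
  have hx : Admissible x y := admissible_multL m hs hsZ
  have hx' : Admissible y y' := admissible_multR m hs hden
  have hH : HodgeCondition m m 0 x y y y' := hodgeCondition_mult m s hm
  set κ : ℝ := ((m:ℝ) + 1) ^ (((m:ℝ) + 1) * s - 1) with hκdef
  have hκ : IsAlgebraic ℚ κ := isAlgebraic_gaussMultConst m s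
  have hsR : (0 : ℝ) < (s : ℝ) := by exact_mod_cast hs
  have hD : DeligneIdentity 0 x y y y' κ := by
    unfold DeligneIdentity
    rw [pow_zero, mul_one]
    have hmain := prod_beta_mult m hsR
    have hxR : ∀ i : Fin m, ((x i : ℚ) : ℝ) = (((i : ℕ) : ℝ) + 1) / ((m : ℝ) + 1) := fun i => by
      simp only [hxdef]; push_cast; ring
    have hy'R : ∀ j : Fin m, ((y' j : ℚ) : ℝ) = (((j : ℕ) : ℝ) + 1) * s := fun j => by
      simp only [hy'def]; push_cast; ring
    simp only [hxR, hy'R, hydef]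
    exact hmain
  -- the crux in canonical form
  have E := (gammaHodgeSector_iff_canonical.mp h) m m 0 x y y y' κ hx hx' hH hκ hD
  -- box side
  have hr : IsCubeBetaRep x y r := isCubeBetaRep_multBox m s r hrd hri
  have e1 : toFormalPeriod (of r) = toFormalPeriod (of (cubeRep x y hx.pos)) :=
    (equivalent_cubeRep_of_isCubeBetaRep hx.pos hr).toFormalPeriod_eq
  have e2 : toFormalPeriod (of (ballCubeRep 0 y y' κ hκ hx'.pos)) =
      kap κ hκ * betaClass (1 / 2) (1 / 2) ^ 0 * ∏ l, betaClass (y l) (y' l) :=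
    stub_products.2.1 0 y y' κ hκ _ hx'.pos (isBallCubeRep_ballCubeRep 0 y y' κ hκ hx'.pos)
  -- simplex side
  have hy'pos : ∀ j, 0 < y' j := fun j => (hx'.pos j).2
  have e3 : toFormalPeriod (of r') =
      kap κ hκ * ∏ j, toFormalPeriod (of (betaRep s (y' j) hs (hy'pos j))) :=
    bigSimplex_toFormalPeriod m s hs r' hr'd hr'i y' (fun j => rfl)
      (fun j => betaRep s (y' j) hs (hy'pos j)) (fun j => rfl) (fun j => fun _ _ => rfl) hκ
  have e4 : ∏ l, betaClass (y l) (y' l) = ∏ j, toFormalPeriod (of (betaRep s (y' j) hs (hy'pos j))) :=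
    Finset.prod_congr rfl fun j _ => betaClass_eq s (y' j) hs (hy'pos j)
  change of r - of r' ∈ relations
  rw [← toFormalPeriod_eq_iff, e1, E.toFormalPeriod_eq, e2, e3, pow_zero, mul_one, e4]

/-- The same containment for the verbatim copy of the crux in route `MotivatedMoves`
(stmt-KontsevichZagierPeriods-3742 is shared; the two route decls have the same body).
[cite: Deligne1982HodgeCycles, Thm. 7.18] -/
theorem multiplicationAccessible_of_gammaHodgeSector_of_lt_den'
    (h : Summit.KontsevichZagierPeriods.KontsevichZagierPeriods.Theses.MotivatedMoves.GammaHodgeSector)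
    (m : ℕ) (s : ℚ) (hm : 1 ≤ m) (hs : 0 < s) (hden : m < s.den)
    (r r' : IntegralRep m) (hrd : r.domain = {x | ∀ i, x i ∈ Set.Ioo (0:ℝ) 1})
    (hri : Set.EqOn r.integrand (fun x => ∏ i : Fin m,
      (x i) ^ ((((i:ℕ):ℝ) + 1) / ((m:ℝ) + 1) - 1) * (1 - x i) ^ ((s:ℝ) - 1)) r.domain)
    (hr'd : r'.domain = {x | (∀ i, 0 < x i) ∧ ∑ i, x i < (m:ℝ) + 1})
    (hr'i : Set.EqOn r'.integrand
      (fun x => ((∏ i, x i) * ((m:ℝ) + 1 - ∑ i, x i)) ^ ((s:ℝ) - 1)) r'.domain) :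
    Equivalent r r' :=
  multiplicationAccessible_of_gammaHodgeSector_of_lt_den h m s hm hs hden r r' hrd hri hr'd hr'i

/-! ## §4 SelbergAMGM's Γ-sector contains the whole multiplication family -/

/-- **`GammaSector (stmt-5620) → MultiplicationAccessible (stmt-12305)`**: the simplex side of the
instance `(m, s)` is KZ-equivalent to the Beta-monomial representation
`κ · [(0,1)^m, Π_j t_j^{s−1}(1−t_j)^{(j+1)s−1}]` (same class `κ · Π_j β(s, (j+1)s)` by the tree's
scaling + peeling chain and the cube product), the box side is a Beta monomial with constant `1`,
the values agree by Gauss's multiplication formula in Beta form (`prod_beta_mult`), and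
`GammaSector` connects the two monomials. No integrality guard is needed. [cite: AndrewsAskeyRoy1999, Thm 1.5.2] -/
theorem multiplicationAccessible_of_selbergGammaSector (hΓ : GammaSector) :
    MultiplicationAccessible := by
  intro m s hm hs r r' hrd hri hr'd hr'i
  classical
  set x : Fin m → ℚ := fun i => (((i : ℕ) : ℚ) + 1) / ((m : ℚ) + 1) with hxdef
  set y : Fin m → ℚ := fun _ => s with hydef
  set y' : Fin m → ℚ := fun j => (((j : ℕ) : ℚ) + 1) * s with hy'def
  have hpos : ∀ i, 0 < x i ∧ 0 < y i := fun i => ⟨by positivity, hs⟩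
  have hpos' : ∀ j, 0 < y j ∧ 0 < y' j := fun j => ⟨hs, by positivity⟩
  have hy'pos : ∀ j, 0 < y' j := fun j => (hpos' j).2
  set κ : ℝ := ((m:ℝ) + 1) ^ (((m:ℝ) + 1) * s - 1) with hκdef
  have hκ : IsAlgebraic ℚ κ := isAlgebraic_gaussMultConst m s
  have hsR : (0 : ℝ) < (s : ℝ) := by exact_mod_cast hs
  -- the Beta-monomial form `Q = κ · cube(y, y')` of the simplex side
  obtain ⟨q, hqd, hqi⟩ := exists_cubeBetaRep y y' hpos'
  have eq1 : toFormalPeriod (of (q.constMul κ hκ)) = kap κ hκ * ∏ j, betaClass (y j) (y' j) := by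
    rw [toFormalPeriod_of_constMul, cubeProduct_holds y y' q hpos' ⟨hqd, hqi⟩]
    rfl
  have e3 : toFormalPeriod (of r') =
      kap κ hκ * ∏ j, toFormalPeriod (of (betaRep s (y' j) hs (hy'pos j))) :=
    bigSimplex_toFormalPeriod m s hs r' hr'd hr'i y' (fun j => rfl)
      (fun j => betaRep s (y' j) hs (hy'pos j)) (fun j => rfl) (fun j => fun _ _ => rfl) hκ
  have e4 : ∏ l, betaClass (y l) (y' l) = ∏ j, toFormalPeriod (of (betaRep s (y' j) hs (hy'pos j))) :=
    Finset.prod_congr rfl fun j _ => betaClass_eq s (y' j) hs (hy'pos j)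
  have hQr' : Equivalent (q.constMul κ hκ) r' := by
    change of (q.constMul κ hκ) - of r' ∈ relations
    rw [← toFormalPeriod_eq_iff, eq1, e3, e4]
  -- values
  have hr : IsCubeBetaRep x y r := isCubeBetaRep_multBox m s r hrd hri
  have hxR : ∀ i : Fin m, ((x i : ℚ) : ℝ) = (((i : ℕ) : ℝ) + 1) / ((m : ℝ) + 1) := fun i => by
    simp only [hxdef]; push_cast; ring
  have hy'R : ∀ j : Fin m, ((y' j : ℚ) : ℝ) = (((j : ℕ) : ℝ) + 1) * s := fun j => by
    simp only [hy'def]; push_cast; ring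
  have hv : r.value = (q.constMul κ hκ).value := by
    rw [IntegralRep.value_constMul, value_of_isCubeBetaRep hpos hr,
      value_of_isCubeBetaRep hpos' ⟨hqd, hqi⟩]
    simp only [hxR, hy'R, hydef]
    exact prod_beta_mult m hsR
  -- `GammaSector` connects the two monomials
  have hrQ : Equivalent r (q.constMul κ hκ) :=
    hΓ r (q.constMul κ hκ)
      ⟨1, x, y, isAlgebraic_one, hpos, hr.1, fun t ht => by beta_reduce; rw [hr.2 ht, one_mul]⟩
      ⟨κ, y, y', hκ, hpos', by rw [IntegralRep.domain_constMul, hqd], fun t ht => by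
        rw [IntegralRep.domain_constMul] at ht
        rw [IntegralRep.integrand_constMul]
        show κ * q.integrand t = κ * _
        rw [hqi ht]⟩
      hv
  exact hrQ.trans hQr'

end Summit.KontsevichZagierPeriods.GammaHodgeSectorKO

end
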